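import Literature.Computability.Complexity.CodeFPListKit
import Literature.Computability.Complexity.CodeFPBudgets
import Literature.Computability.Complexity.CodeFPLists
import Literature.Computability.Complexity.CodeFPFinite
import Literature.Computability.Complexity.CodeFPStrings
import Literature.Computability.Complexity.CookBridges
import Summits.PneNP.PneNP.Theorems.RankOneQuadAvoidFPCorrect

/-!
# B4-FP, part 3/3: polynomial time, and the FP leaf for rank-one quadratic tables

Cell pnp-ideate, ROUND-18 by-product B4 (p3's `RankOneQuadAvoid.avoid_rule`), typed: the machine `r1Str k` of part 1
is a `CodeFP` program — a finite lookup (`r1Row`), maps over the decoded outputs, ONE span test over `n + 1`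
coordinates for the inconsistency of the affine system, and a `findIdx` whose test is two span tests
(`Nc03Reduction.codeFP_inSpan`, Gaussian elimination over `𝔽₂`) — hence `IsPolyTime (r1Str k)`; with part 2's
`r1Str_correct` this gives the leaf, for EVERY locality `k`,

  `rankOneQuad_localAvoidLinearFP k : LocalAvoidLinearFP k (fun _ _ I => ∀ j, IsRankOneQuad (I.table j))`, `C = 3`:

range avoidance at linear stretch `m ≥ 3n` is in FP for the `k`-local maps each of whose tables is `c ⊕ (A ∧ B)` with
`A, B` parities of some of the read bits (possibly negated) — AND / OR / NAND / NOR of two parities, e.g. the `NC⁰₄`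
tables `(x₀ ⊕ x₁) ∧ (x₂ ⊕ x₃)`, `x₀ ∧ (x₁ ⊕ x₂ ⊕ x₃)`.  Restricted-model algorithmic rung of the range-avoidance
ladder; it says nothing about `P` versus `NP`.
-/

set_option linter.dupNamespace false -- `Summit.PneNP.PneNP.…`: summit = sub-problem name (D-0017 single-conjunct layout)

namespace Summit.PneNP.PneNP.Theorems.RankOneQuadAvoidFP

open Literature.Computability.Complexity
open Summit.PneNP.PneNP.Theorems.LtfLocalAvoidFP (allBits tableOfBits)
open Summit.PneNP.PneNP.Theorems.LocalMapDecodeFP (decode hdrN outE codeFP_decode codeFP_hdrN)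
open Summit.PneNP.PneNP.Theorems.Nc03Reduction (inSpan codeFP_inSpan)

section PolyTime

open CodeFP

/-- Code of the affine data of one factor `(row, constant bit)`. -/
abbrev facE : List ℕ × Bool → List Bool := pairE (rawE natE) bitE

/-- Code of a per-output record `((row₁, b₁), (row₂, b₂), c)`. -/
abbrev rrecE : RRec → List Bool := pairE facE (pairE facE bitE)

variable (k : ℕ)

/-- The rank-one data of a table block is a finite lookup, hence polynomial time. -/
theorem codeFP_r1Row : CodeFP strE rrecE (r1Row k) := by
  have he : Function.Injective strE := fun _ _ h => h
  exact (ofList (eα := strE) he rrecE (fun tab => r1Data (tableOfBits k tab)) (([], false), ([], false), false)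
    (allBits (2 ^ k))).congr fun tab => by unfold r1Row; split_ifs <;> rfl

/-- Reading positions at a list of support positions is polynomial time. -/
theorem codeFP_readAt : CodeFP (pairE (rawE natE) (rawE natE)) (rawE natE) (fun q => q.2.map fun i => q.1.getD i 0) :=
  (map (σ := List ℕ) (eσ := rawE natE) (α := ℕ) (eα := natE) (g := fun q => q.1.getD q.2 0)
    (rawGetD natE (d := 0) natE_zero)).congr fun _ => rfl

/-- Classifying a decoded output is polynomial time. -/
theorem codeFP_rcls : CodeFP outE rrecE (rcls k) := by
  have hd : CodeFP outE rrecE (fun o => r1Row k o.1) := ((codeFP_r1Row k).comp (fst strE (rawE natE))).congr fun _ => rfl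
  have hrow : CodeFP outE (rawE natE) (fun o => o.2) := snd strE (rawE natE)
  have h1 : CodeFP outE (rawE natE) (fun o => (r1Row k o.1).1.1.map fun i => o.2.getD i 0) :=
    (codeFP_readAt.comp (hrow.pair hd.fst'.fst')).congr fun _ => rfl
  have h2 : CodeFP outE (rawE natE) (fun o => (r1Row k o.1).2.1.1.map fun i => o.2.getD i 0) :=
    (codeFP_readAt.comp (hrow.pair hd.snd'.fst'.fst')).congr fun _ => rfl
  exact ((h1.pair hd.fst'.snd').pair ((h2.pair hd.snd'.fst'.snd').pair hd.snd'.snd')).congr fun _ => rfl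

/-- Classifying all outputs is polynomial time. -/
theorem codeFP_rrecs : CodeFP (rawE outE) (rawE rrecE) (rrecs k) := (map₀ (codeFP_rcls k)).congr fun _ => rfl

variable {k}

/-- An augmented row is polynomial time (in `N` unary and the factor data). -/
theorem codeFP_augOf : CodeFP (pairE unE facE) (rawE natE) (fun q => augOf q.1 q.2) := by
  have hN : CodeFP (pairE unE facE) (rawE natE) (fun q => [q.1]) :=
    ((rawSingleton natE).comp (natOfUn.comp (fst unE facE))).congr fun _ => rfl
  have happ : CodeFP (pairE unE facE) (rawE natE) (fun q => q.2.1 ++ [q.1]) :=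
    ((rawAppend natE).comp ((snd unE facE).fst'.pair hN)).congr fun _ => rfl
  exact ((snd unE facE).snd'.ite (snd unE facE).fst' happ).congr fun _ => rfl

/-- The augmented row list is polynomial time. -/
theorem codeFP_augRows : CodeFP (pairE unE (rawE rrecE)) (rawE (rawE natE)) (fun q => augRows q.1 q.2) := by
  have ha1 : CodeFP (pairE unE rrecE) (rawE natE) (fun t => augOf t.1 t.2.1) :=
    (codeFP_augOf.comp ((fst unE rrecE).pair (snd unE rrecE).fst')).congr fun _ => rfl
  have ha2 : CodeFP (pairE unE rrecE) (rawE natE) (fun t => augOf t.1 t.2.2.1) :=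
    (codeFP_augOf.comp ((fst unE rrecE).pair (snd unE rrecE).snd'.fst')).congr fun _ => rfl
  have hitem : CodeFP (pairE unE rrecE) (rawE (rawE natE)) (fun t => [augOf t.1 t.2.1, augOf t.1 t.2.2.1]) :=
    ((rawAppend (rawE natE)).comp (((rawSingleton (rawE natE)).comp ha1).pair ((rawSingleton (rawE natE)).comp ha2))).congr
      fun _ => rfl
  exact ((flatten (rawE natE)).comp (map hitem)).congr fun _ => rfl

/-- **The inconsistency test is polynomial time** (one span test over `N + 1` coordinates). -/
theorem codeFP_incons : CodeFP (pairE unE (rawE rrecE)) bitE (fun q => incons q.1 q.2) := by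
  have hN1 : CodeFP (pairE unE (rawE rrecE)) unE (fun q => q.1 + 1) := (unSucc.comp (fst unE (rawE rrecE))).congr fun _ => rfl
  have hv : CodeFP (pairE unE (rawE rrecE)) (rawE natE) (fun q => [q.1]) :=
    ((rawSingleton natE).comp (natOfUn.comp (fst unE (rawE rrecE)))).congr fun _ => rfl
  exact (codeFP_inSpan.comp (hN1.pair (codeFP_augRows.pair hv))).congr fun _ => rfl

/-- Indexing the records is polynomial time. -/
theorem codeFP_tagged : CodeFP (rawE rrecE) (rawE (pairE natE rrecE)) tagged :=
  ((mapIdx (σ := Unit) (eσ := unitE) (eα := rrecE) (eβ := pairE natE rrecE) (g := fun t => t.2)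
    (snd unitE (pairE natE rrecE))).comp ((const _ ()).pair (CodeFP.id (rawE rrecE)))).congr fun _ => rfl

/-- The other outputs' rows are polynomial time. -/
theorem codeFP_others : CodeFP (pairE (rawE rrecE) natE) (rawE (rawE natE)) (fun q => others q.1 q.2) := by
  have hp : CodeFP (pairE natE (pairE natE rrecE)) bitE (fun t => !(t.2.1 == t.1)) :=
    ((beq natE_injective).comp ((snd natE (pairE natE rrecE)).fst'.pair (fst natE (pairE natE rrecE)))).not
  have hfil : CodeFP (pairE (rawE rrecE) natE) (rawE (pairE natE rrecE))
      (fun q => (tagged q.1).filter fun t => !(t.1 == q.2)) :=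
    ((filter hp).comp ((snd (rawE rrecE) natE).pair (codeFP_tagged.comp (fst (rawE rrecE) natE)))).congr fun _ => rfl
  have hitem : CodeFP (pairE natE rrecE) (rawE (rawE natE)) (fun t => [t.2.1.1, t.2.2.1.1]) :=
    ((rawAppend (rawE natE)).comp (((rawSingleton (rawE natE)).comp (snd natE rrecE).fst'.fst').pair
      ((rawSingleton (rawE natE)).comp (snd natE rrecE).snd'.fst'.fst'))).congr fun _ => rfl
  exact ((flatten (rawE natE)).comp ((map₀ hitem).comp hfil)).congr fun _ => rfl

/-- **The goodness test is polynomial time** (two span tests). -/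
theorem codeFP_good : CodeFP (pairE (pairE unE (rawE rrecE)) (pairE natE rrecE)) bitE (fun q => good q.1.1 q.1.2 q.2) := by
  have hN : CodeFP (pairE (pairE unE (rawE rrecE)) (pairE natE rrecE)) unE (fun q => q.1.1) := (fst _ _).fst'
  have hoth : CodeFP (pairE (pairE unE (rawE rrecE)) (pairE natE rrecE)) (rawE (rawE natE)) (fun q => others q.1.2 q.2.1) :=
    (codeFP_others.comp ((fst _ _).snd'.pair (snd _ _).fst')).congr fun _ => rfl
  have h1 : CodeFP (pairE (pairE unE (rawE rrecE)) (pairE natE rrecE)) bitE (fun q => inSpan q.1.1 (others q.1.2 q.2.1) q.2.2.1.1) :=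
    (codeFP_inSpan.comp (hN.pair (hoth.pair (snd _ _).snd'.fst'.fst'))).congr fun _ => rfl
  have h2 : CodeFP (pairE (pairE unE (rawE rrecE)) (pairE natE rrecE)) bitE
      (fun q => inSpan q.1.1 (others q.1.2 q.2.1) q.2.2.2.1.1) :=
    (codeFP_inSpan.comp (hN.pair (hoth.pair (snd _ _).snd'.snd'.fst'.fst'))).congr fun _ => rfl
  exact (h1.and h2).congr fun _ => rfl

/-- The first good output is polynomial time. -/
theorem codeFP_iStar : CodeFP (pairE unE (rawE rrecE)) natE (fun q => iStar q.1 q.2) :=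
  ((findIdxFP codeFP_good).comp ((CodeFP.id _).pair (codeFP_tagged.comp (snd unE (rawE rrecE))))).congr fun _ => rfl

/-- The printed bits are polynomial time. -/
theorem codeFP_outR : CodeFP (pairE unE (rawE rrecE)) (rawE bitE) (fun q => outR q.1 q.2) := by
  have hσ : CodeFP (pairE unE (rawE rrecE)) (pairE bitE natE) (fun q => (!incons q.1 q.2, iStar q.1 q.2)) :=
    codeFP_incons.not.pair codeFP_iStar
  have hg : CodeFP (pairE (pairE bitE natE) (pairE natE rrecE)) bitE (fun t => !t.2.2.2.2 ^^ (t.1.1 && (t.2.1 == t.1.2))) :=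
    (snd _ _).snd'.snd'.snd'.not.xor ((fst _ _).fst'.and ((beq natE_injective).comp ((snd _ _).fst'.pair (fst _ _).snd')))
  exact ((mapIdx hg).comp (hσ.pair (snd unE (rawE rrecE)))).congr fun _ => rfl

/-- **The rank-one avoider is computed on codes in polynomial time.** -/
theorem codeFP_r1Str (k : ℕ) : CodeFP strE strE (r1Str k) :=
  (bitsToStr.comp (codeFP_outR.comp (codeFP_hdrN.pair ((codeFP_rrecs k).comp (codeFP_decode k))))).congr fun _ => rfl

/-- **`r1Str k` is polynomial-time computable** (`IsPolyTime`). -/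
theorem isPolyTime_r1Str (k : ℕ) : IsPolyTime (r1Str k) := by
  obtain ⟨f, hf, hfw⟩ := codeFP_r1Str k
  have h : f = r1Str k := funext fun w => hfw w
  rw [h] at hf
  exact (CookBridges.isPolyTime_iff _).2 hf

end PolyTime

/-! ## The leaf -/

/-- **B4 as an FP rung, every locality `k`**: range avoidance at linear stretch `m ≥ 3n` is in FP — by the ONE
polynomial-time function `r1Str k` — for the `k`-local maps each of whose tables is RANK-ONE QUADRATIC
(`c ⊕ (A ∧ B)`, `A`, `B` parities of some of the read bits, possibly negated: AND / OR / NAND / NOR of two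
parities, and the affine tables).  The algorithm is pnp-ideate-p3's explicit rule `RankOneQuadAvoid.avoid_rule`
(inconsistent affine system ⇒ all-products-one point; else flip a GOOD output, which exists when `m > 2n`),
realised by span tests.  Restricted-model algorithmic rung of the range-avoidance ladder (cell pnp-ideate,
ROUND-18 by-product B4); it says nothing about `P` versus `NP`. -/
theorem rankOneQuad_localAvoidLinearFP (k : ℕ) : LocalAvoidLinearFP k (fun _ _ I => ∀ j, IsRankOneQuad (I.table j)) :=
  ⟨3, r1Str k, isPolyTime_r1Str k, fun _ _ I hQ hn hm => r1Str_correct I hQ hn hm⟩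

end Summit.PneNP.PneNP.Theorems.RankOneQuadAvoidFP
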